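import Summits.BirchSwinnertonDyer.BirchSwinnertonDyer.Theorems.GenusKolyvaginAtTwoPowDvdShaCardAtTwoRTGenusKernelHabitat
import Summits.BirchSwinnertonDyer.BirchSwinnertonDyer.Theorems.GenusKolyvaginAtTwoPowDvdShaCardAtTwoRTJointCountDisjoint
import Mathlib.GroupTheory.FiniteAbelian.Basic
import Summits.BirchSwinnertonDyer.BirchSwinnertonDyer.Theorems.GenusKolyvaginAtTwoPowDvdShaCardAtTwoRTLadderFrame
import HarnessLib

/-!
# Route `GenusKolyvaginAtTwo`, LINE 18 (L_T `PowDvdShaCardAtTwoRT`, stmt-BirchSwinnertonDyer-23242): L_T's CONCLUSION FROM THE TWO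
# ℚ-SIDE LADDERS OF STUB L AND THE DISJOINTNESS OF THEIR IMAGES IN `H¹(K, W_K)` — every transfer binder discharged by name

Seat `bsd-line-gk2-p2` g17 (cell `bsd-f1-sign2`), `--supports stmt-BirchSwinnertonDyer-23242` (helper; closes nothing).
THEOREMS ONLY (no definition, no named fact, no `sorry`); BSD is not proved by any of this; L_T is NOT proved (the disjointness is a hypothesis).

WHAT.  gk2-p4 g17's transport-tolerant two-ladder count `pow_two_mul_dvd_natCard_of_ladders_map_of_disjoint_of_even` (p698961, J′ road after the
death of stub J) charges every bit to a named object: the target `S = Ш(W_K)[2^∞]`, the intersection of the two IMAGES, the parts of `ker f`,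
`ker g` met by the spans, and the parity of `v₂ #S`.  This file instantiates it ON THE HABITAT with every binder but the disjointness discharged
by tree theorems: `f = res_K : H¹(ℚ,W) → H¹(K,W_K)` has kernel of order `≤ 2^{rank W(K)} = 2` (gk2-p3 g16
`natCard_localRestrictionKer_le_two_pow_mordellWeilRank`); `g = e ∘ res_K : H¹(ℚ,Wd) → H¹(K,W_K)` is INJECTIVE (this seat:
`localRestrictionKer_twin_eq_bot_of_finite_odd`, `W(ℚ)` finite of odd order) for the twist isomorphism `e : H¹(K,Wd_K) ≃ H¹(K,W_K)`, `Ш ↔ Ш`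
(this seat: `exists_galH1Equiv_twin_baseChange_sha`); `v₂ #Ш(W_K)[2^∞]` is even (Cassels–Tate over `K`, gk2-p1 g13); the spans are finite
(finitely generated by classes of `2`-power order).  gk2-p4's parallel
`pow_two_mul_dvd_natCard_sha_baseChange_of_res_ladders` (p699657) keeps `g`, its injectivity and `#ker res ∣ 2` as hypotheses; here they are
DISCHARGED from the habitat.  RESULT:

* **`pow_two_mul_dvd_natCard_sha_of_ladders_of_disjoint`** — `[K:ℚ] = 2`, `W(K)[2] = 0`, `rank W(K) = 1`, `W(ℚ)` finite of odd order,
  `Wd = Cd • W^{(d_K)}`, `e` as above, stub L's two ladders `x`, `y` (antitone `M`, `M(2T) = 0`, rung families with restrictions in `Ш(W_K)`,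
  `Ш(Wd_K)`), and `Disjoint (span(res x)) (span(e ∘ res y))` in `H¹(K, W_K)` ⟹ **`2^(2·M 0) ∣ #Ш(W_K/K)[2^∞]`** — for `M 0 = M₀` the conclusion
  of L_T VERBATIM, for EVERY genus budget `B`, with no `ord₂ C(Wd)`, no Milne defect, no GP.
So on the J′ road the Deep regime of LINE 18 is reduced BY NAME to ONE statement about Kolyvagin's classes: the two K-spans are disjoint
(equivalently: the `2`-torsion of the (+)-span avoids the (−)-span; at odd `p` this is the eigenspace decomposition, at `2` it is the
research-grade residual isolated by gk2-p4's probe-budget analysis and gk2-p3's J_K).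

References: [McCallumLMS1991] §5 Thm. 5.4; [Kolyvagin1991StructureSha]; [Kramer1981] §1, §5 Prop. 8; [SilvermanAEC2009] X.4.14, X.5 Cor. 5.4.
-/

set_option autoImplicit false
-- the Theorems namespace of this sub repeats the summit name by design (D-0017 nested layout)
set_option linter.dupNamespace false

noncomputable section

open scoped Classical

namespace Summit.BirchSwinnertonDyer.BirchSwinnertonDyer.Theorems.GenusExact.PlusDescent

open Literature.NumberTheory.EllipticCurves WeierstrassCurve NumberField

section Capstone

variable {G : Type} [AddCommGroup G]

/-- The subgroup generated by a finite set (a `Finset`) of elements of finite additive order in a commutative group is finite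
(`Set` form: gk2-p4's `finite_closure_of_isOfFinAddOrder` in `…RTJointCountDisjointRes`). [folklore] -/
theorem finite_closure_finset_of_isOfFinAddOrder (s : Finset G) (hs : ∀ z ∈ s, IsOfFinAddOrder z) :
    Finite (AddSubgroup.closure (s : Set G)) := by
  haveI : AddGroup.FG (AddSubgroup.closure (s : Set G)) := AddGroup.closure_finset_fg s
  refine AddCommGroup.finite_of_fg_torsion _ fun u ↦ ?_
  have hle : AddSubgroup.closure (s : Set G) ≤ AddCommGroup.torsion G :=
    (AddSubgroup.closure_le _).mpr fun z hz ↦ (AddCommGroup.mem_torsion z).mpr (hs z hz)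
  have hu : IsOfFinAddOrder (u : G) := (AddCommGroup.mem_torsion _).mp (hle u.2)
  obtain ⟨n, hn, hnu⟩ := hu.exists_nsmul_eq_zero
  exact isOfFinAddOrder_iff_nsmul_eq_zero.mpr ⟨n, hn, Subtype.ext (by simpa using hnu)⟩

/-- The subgroup generated by elements killed by powers of `p` consists of elements killed by powers of `p`. [folklore] -/
theorem exists_pow_nsmul_eq_zero_of_mem_closure {p : ℕ} (s : Set G) (hs : ∀ z ∈ s, ∃ n : ℕ, p ^ n • z = 0)
    {u : G} (hu : u ∈ AddSubgroup.closure s) : ∃ n : ℕ, p ^ n • u = 0 := by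
  induction hu using AddSubgroup.closure_induction with
  | mem z hz => exact hs z hz
  | zero => exact ⟨0, smul_zero _⟩
  | add a b _ _ ha hb =>
    obtain ⟨m, hm⟩ := ha
    obtain ⟨n, hn⟩ := hb
    refine ⟨m + n, ?_⟩
    have ha : p ^ (m + n) • a = 0 := by rw [pow_add, mul_comm, ← smul_smul, hm, smul_zero]
    have hb : p ^ (m + n) • b = 0 := by rw [pow_add, ← smul_smul, hn, smul_zero]
    rw [smul_add, ha, hb, add_zero]
  | neg a _ ha =>
    obtain ⟨m, hm⟩ := ha
    exact ⟨m, by rw [smul_neg, hm, neg_zero]⟩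

/-- **Disjointness of `2`-primary subgroups is decided on the socles**: if every element of `U` is killed by a power of `2` and the
order-`2` layers `U ∩ A[2]`, `V ∩ A[2]` meet trivially, then `U ∩ V = 0` (a non-zero `z ∈ U ∩ V` of order `2^k` yields `2^{k−1} z` of
order `2` in both).  This is the form in which J′'s disjointness is an «order-2 avoidance» (gk2-p4 memo §6). [folklore] -/
theorem disjoint_of_disjoint_inf_torsionBy_two {A : Type} [AddCommGroup A] (U V : AddSubgroup A)
    (hU : ∀ u ∈ U, ∃ n : ℕ, 2 ^ n • u = 0)
    (h : Disjoint (U ⊓ AddSubgroup.torsionBy A 2) (V ⊓ AddSubgroup.torsionBy A 2)) : Disjoint U V := by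
  rw [disjoint_iff, eq_bot_iff]
  rintro z ⟨hzU, hzV⟩
  rw [AddSubgroup.mem_bot]
  by_contra hz0
  have hex : ∃ n : ℕ, 2 ^ n • z = 0 := hU z hzU
  set k := Nat.find hex with hk
  have hkz : 2 ^ k • z = 0 := Nat.find_spec hex
  have hk0 : k ≠ 0 := fun h0 ↦ hz0 (by simpa [h0] using hkz)
  obtain ⟨j, hj⟩ := Nat.exists_eq_succ_of_ne_zero hk0
  have hw0 : 2 ^ j • z ≠ 0 := Nat.find_min hex (by rw [← hk, hj]; exact Nat.lt_succ_self j)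
  have hw2 : 2 • (2 ^ j • z) = 0 := by
    rw [hj, pow_succ, mul_comm, ← smul_smul] at hkz
    exact hkz
  have hwT : 2 ^ j • z ∈ AddSubgroup.torsionBy A 2 := by
    change 2 ^ j • z ∈ (Submodule.torsionBy ℤ A 2).toAddSubgroup
    rw [Submodule.mem_toAddSubgroup, Submodule.mem_torsionBy_iff, two_zsmul]
    rwa [two_nsmul] at hw2
  have hbot : 2 ^ j • z ∈ (⊥ : AddSubgroup A) :=
    h.le_bot ⟨⟨U.nsmul_mem hzU _, hwT⟩, ⟨V.nsmul_mem hzV _, hwT⟩⟩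
  exact hw0 (AddSubgroup.mem_bot.mp hbot)

variable (W : WeierstrassCurve ℚ) [W.IsElliptic] (K : Type) [Field K] [NumberField K]

/-- **L_T's conclusion from stub L's two ℚ-side ladders and the DISJOINTNESS of their `K`-images.**  See the module docstring: all transfer
binders of gk2-p4's `pow_two_mul_dvd_natCard_of_ladders_map_of_disjoint_of_even` are discharged on the habitat (`[K:ℚ] = 2`, `W(K)[2] = 0`,
`rank W(K) = 1`, `W(ℚ)` finite of odd order, `Wd = Cd • W^{(d_K)}`, twist isomorphism `e` of `exists_galH1Equiv_twin_baseChange_sha`); what is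
ASSUMED is the disjointness of the span of the restricted (+)-ladder and the span of the twisted-restricted (−)-ladder in `H¹(K, W_K)`.
[cite: McCallumLMS1991, §5 Thm. 5.4] [cite: Kolyvagin1991StructureSha] [cite: Kramer1981, §5 Prop. 8] -/
theorem pow_two_mul_dvd_natCard_sha_of_ladders_of_disjoint (h2 : Module.finrank ℚ K = 2)
    (hK2 : ∀ P : (W.baseChange K).toAffine.Point, 2 • P = 0 → P = 0) (hrank : (W.baseChange K).mordellWeilRank = 1)
    [Finite W.toAffine.Point] (hodd : Odd (Nat.card W.toAffine.Point))
    {Wd : WeierstrassCurve ℚ} (Cd : VariableChange ℚ) (hWd : Cd • W.quadraticTwist (NumberField.discr K : ℚ) = Wd)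
    (e : (Wd.baseChange K).galH1 ≃+ (W.baseChange K).galH1)
    (he : ∀ c : (Wd.baseChange K).galH1, c ∈ (Wd.baseChange K).sha ↔ e c ∈ (W.baseChange K).sha)
    (T : ℕ) (M : ℕ → ℕ) (hM : ∀ j, M (j + 1) ≤ M j) (hMT : M (2 * T) = 0)
    (x : (m : ℕ) → Fin (2 * m + 2) → W.galH1)
    (hx : ∀ m < T, (∀ i, resBaseChange W K (x m i) ∈ (W.baseChange K).sha) ∧
      (∀ i, addOrderOf (x m i) = 2 ^ (M (2 * m) - M (2 * m + 1))) ∧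
      ∀ c : Fin (2 * m + 2) → ℤ, ∑ i, c i • x m i = 0 → ∀ i, ((2 ^ (M (2 * m) - M (2 * m + 1)) : ℕ) : ℤ) ∣ c i)
    (y : (m : ℕ) → Fin (2 * m + 2) → Wd.galH1)
    (hy : ∀ m < T, (∀ i, resBaseChange Wd K (y m i) ∈ (Wd.baseChange K).sha) ∧
      (∀ i, addOrderOf (y m i) = 2 ^ (M (2 * m + 1) - M (2 * m + 2))) ∧
      ∀ c : Fin (2 * m + 2) → ℤ, ∑ i, c i • y m i = 0 → ∀ i, ((2 ^ (M (2 * m + 1) - M (2 * m + 2)) : ℕ) : ℤ) ∣ c i)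
    (hdis : Disjoint
      ((AddSubgroup.closure (((Finset.range T).biUnion fun m ↦ Finset.univ.image (x m) : Finset W.galH1) : Set W.galH1)).map
        (resBaseChange W K))
      ((AddSubgroup.closure (((Finset.range T).biUnion fun m ↦ Finset.univ.image (y m) : Finset Wd.galH1) : Set Wd.galH1)).map
        ((e : (Wd.baseChange K).galH1 →+ (W.baseChange K).galH1).comp (resBaseChange Wd K)))) :
    2 ^ (2 * M 0) ∣ Nat.card (AddCommGroup.primaryComponent (W.baseChange K).sha 2) := by
  -- if `Ш(W_K)[2^∞]` is infinite there is nothing to prove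
  by_cases hfin : Finite (AddCommGroup.primaryComponent (W.baseChange K).sha 2)
  swap
  · haveI := not_finite_iff_infinite.mp hfin
    rw [Nat.card_eq_zero_of_infinite]; exact dvd_zero _
  haveI := hfin
  haveI hEK : (W.baseChange K).IsElliptic := by rw [WeierstrassCurve.baseChange]; infer_instance
  haveI : Algebra.IsQuadraticExtension ℚ K := ⟨h2⟩
  haveI : IsGalois ℚ K := inferInstance
  -- the target group `S = Ш(W_K)[2^∞]` inside `A = H¹(K, W_K)`
  set A := (W.baseChange K).galH1 with hA
  set P2 := AddCommGroup.primaryComponent (W.baseChange K).sha 2 with hP2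
  set S : AddSubgroup A := P2.map (W.baseChange K).sha.subtype with hSdef
  have hSinj : Function.Injective (W.baseChange K).sha.subtype := (W.baseChange K).sha.subtype_injective
  have hcardS : Nat.card S = Nat.card P2 := (Nat.card_congr (P2.equivMapOfInjective _ hSinj).toEquiv).symm
  haveI : Finite S := Nat.finite_of_card_ne_zero (by rw [hcardS]; exact Nat.card_pos.ne')
  have hmemS : ∀ {z : A} (hz : z ∈ (W.baseChange K).sha) (a : ℕ), 2 ^ a • z = 0 → z ∈ S := by
    intro z hz a hza
    refine ⟨⟨z, hz⟩, (AddCommGroup.mem_primaryComponent).mpr ⟨a, Subtype.ext ?_⟩, rfl⟩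
    simpa using hza
  -- the two homomorphisms
  set f : W.galH1 →+ A := resBaseChange W K with hf
  set g : Wd.galH1 →+ A := (e : (Wd.baseChange K).galH1 →+ (W.baseChange K).galH1).comp (resBaseChange Wd K) with hg
  -- the two spans, finite
  set sX : Finset W.galH1 := (Finset.range T).biUnion fun m ↦ Finset.univ.image (x m) with hsX
  set sY : Finset Wd.galH1 := (Finset.range T).biUnion fun m ↦ Finset.univ.image (y m) with hsY
  set U : AddSubgroup W.galH1 := AddSubgroup.closure (sX : Set W.galH1) with hU
  set V : AddSubgroup Wd.galH1 := AddSubgroup.closure (sY : Set Wd.galH1) with hV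
  have hmem_sX : ∀ {z}, z ∈ sX → ∃ m, m < T ∧ ∃ i, x m i = z := fun {z} hz ↦ by
    obtain ⟨m, hm, hz⟩ := Finset.mem_biUnion.mp hz
    obtain ⟨i, -, rfl⟩ := Finset.mem_image.mp hz
    exact ⟨m, Finset.mem_range.mp hm, i, rfl⟩
  have hmem_sY : ∀ {z}, z ∈ sY → ∃ m, m < T ∧ ∃ i, y m i = z := fun {z} hz ↦ by
    obtain ⟨m, hm, hz⟩ := Finset.mem_biUnion.mp hz
    obtain ⟨i, -, rfl⟩ := Finset.mem_image.mp hz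
    exact ⟨m, Finset.mem_range.mp hm, i, rfl⟩
  have hxU : ∀ m < T, ∀ i, x m i ∈ U := fun m hm i ↦ AddSubgroup.subset_closure
    (Finset.mem_coe.mpr (Finset.mem_biUnion.mpr ⟨m, Finset.mem_range.mpr hm, Finset.mem_image.mpr ⟨i, Finset.mem_univ _, rfl⟩⟩))
  have hyV : ∀ m < T, ∀ i, y m i ∈ V := fun m hm i ↦ AddSubgroup.subset_closure
    (Finset.mem_coe.mpr (Finset.mem_biUnion.mpr ⟨m, Finset.mem_range.mpr hm, Finset.mem_image.mpr ⟨i, Finset.mem_univ _, rfl⟩⟩))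
  haveI : Finite U := finite_closure_finset_of_isOfFinAddOrder sX fun z hz ↦ by
    obtain ⟨m, hm, i, rfl⟩ := hmem_sX hz
    exact addOrderOf_pos_iff.mp (by rw [(hx m hm).2.1 i]; positivity)
  haveI : Finite V := finite_closure_finset_of_isOfFinAddOrder sY fun z hz ↦ by
    obtain ⟨m, hm, i, rfl⟩ := hmem_sY hz
    exact addOrderOf_pos_iff.mp (by rw [(hy m hm).2.1 i]; positivity)
  -- images inside `S`
  have hfU : U.map f ≤ S := by
    rw [AddSubgroup.map_le_iff_le_comap, hU, AddSubgroup.closure_le]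
    intro z hz
    obtain ⟨m, hm, i, rfl⟩ := hmem_sX hz
    refine AddSubgroup.mem_comap.mpr (hmemS ((hx m hm).1 i) (M (2 * m) - M (2 * m + 1)) ?_)
    rw [hf, ← map_nsmul, ← (hx m hm).2.1 i, addOrderOf_nsmul_eq_zero, map_zero]
  have hgV : V.map g ≤ S := by
    rw [AddSubgroup.map_le_iff_le_comap, hV, AddSubgroup.closure_le]
    intro z hz
    obtain ⟨m, hm, i, rfl⟩ := hmem_sY hz
    refine AddSubgroup.mem_comap.mpr (hmemS ((he _).mp ((hy m hm).1 i)) (M (2 * m + 1) - M (2 * m + 2)) ?_)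
    rw [hg, ← map_nsmul, ← (hy m hm).2.1 i, addOrderOf_nsmul_eq_zero, map_zero]
  -- `#(ker f ∩ U) ∣ 2`: the kernel of restriction has order `≤ 2^{rank W(K)} = 2`
  have hkerf : f.ker = W.localRestrictionKer K := by
    ext c
    rw [AddMonoidHom.mem_ker, hf, mem_ker_resBaseChange_iff]
  have hker₁ : Nat.card ↥(f.ker ⊓ U) ∣ 2 := by
    haveI : Finite (W.localRestrictionKer K) := (finite_localRestrictionKer_numberField W K).to_subtype
    have hle : Nat.card (W.localRestrictionKer K) ≤ 2 := by
      have h := natCard_localRestrictionKer_le_two_pow_mordellWeilRank W K h2 hK2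
      rwa [hrank, pow_one] at h
    have hpos : 0 < Nat.card (W.localRestrictionKer K) := Nat.card_pos
    have hdvd : Nat.card ↥(f.ker ⊓ U) ∣ Nat.card (W.localRestrictionKer K) := by
      rw [← hkerf]
      exact AddSubgroup.card_dvd_of_le inf_le_left
    interval_cases h : Nat.card (W.localRestrictionKer K)
    · rw [Nat.dvd_one.mp hdvd]; exact one_dvd 2
    · exact hdvd
  -- `ker g ∩ V = ⊥`: `e` is injective and the twin has no class dying over `K`
  have hker₂ : g.ker ⊓ V = ⊥ := by
    have hbot := localRestrictionKer_twin_eq_bot_of_finite_odd W K h2 Cd hWd hodd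
    have hkg : g.ker = ⊥ := by
      rw [eq_bot_iff]
      intro c hc
      rw [AddMonoidHom.mem_ker, hg, AddMonoidHom.comp_apply, AddMonoidHom.coe_coe, map_eq_zero_iff e e.injective,
        mem_ker_resBaseChange_iff, hbot] at hc
      exact hc
    rw [hkg, bot_inf_eq]
  -- Cassels–Tate over `K`: `v₂ #S` is even
  have heven : Even (padicValNat 2 (Nat.card S)) := by
    rw [hcardS]
    exact even_padicValNat_of_isSquare Nat.card_pos.ne' (CasselsTateNumberField.isSquare_natCard_primaryComponent_sha (W.baseChange K) 2)
  -- the families sit in the spans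
  have hUfam : ∀ m < T, ∃ x' : Fin (2 * m + 2) → W.galH1, (∀ i, x' i ∈ U) ∧ (∀ i, addOrderOf (x' i) = 2 ^ (M (2 * m) - M (2 * m + 1))) ∧
      ∀ c : Fin (2 * m + 2) → ℤ, ∑ i, c i • x' i = 0 → ∀ i, ((2 ^ (M (2 * m) - M (2 * m + 1)) : ℕ) : ℤ) ∣ c i :=
    fun m hm ↦ ⟨x m, hxU m hm, (hx m hm).2.1, (hx m hm).2.2⟩
  have hVfam : ∀ m < T, ∃ y' : Fin (2 * m + 2) → Wd.galH1, (∀ i, y' i ∈ V) ∧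
      (∀ i, addOrderOf (y' i) = 2 ^ (M (2 * m + 1) - M (2 * m + 2))) ∧
      ∀ c : Fin (2 * m + 2) → ℤ, ∑ i, c i • y' i = 0 → ∀ i, ((2 ^ (M (2 * m + 1) - M (2 * m + 2)) : ℕ) : ℤ) ∣ c i :=
    fun m hm ↦ ⟨y m, hyV m hm, (hy m hm).2.1, (hy m hm).2.2⟩
  have h := pow_two_mul_dvd_natCard_of_ladders_map_of_disjoint_of_even T M hM hMT f g U V S hfU hgV hker₁ hker₂ hdis heven hUfam hVfam
  rwa [hcardS] at h

/-- **Socle form of the capstone.**  Same data; the disjointness is asked only for the ORDER-`2` LAYERS of the two spans in `H¹(K, W_K)`: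
`Disjoint (f(U) ∩ H¹[2]) (g(V) ∩ H¹[2])` — every element of the spans is `2`-primary, so `disjoint_of_disjoint_inf_torsionBy_two` upgrades it.
So the Deep regime of LINE 18 on the J′ road is, BY NAME, «the order-2 classes in the K-span of the restricted (+)-ladder avoid the K-span of the
twisted-restricted (−)-ladder». [cite: McCallumLMS1991, §5 Thm. 5.4] [cite: Kolyvagin1991StructureSha] -/
theorem pow_two_mul_dvd_natCard_sha_of_ladders_of_disjoint_socle (h2 : Module.finrank ℚ K = 2)
    (hK2 : ∀ P : (W.baseChange K).toAffine.Point, 2 • P = 0 → P = 0) (hrank : (W.baseChange K).mordellWeilRank = 1)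
    [Finite W.toAffine.Point] (hodd : Odd (Nat.card W.toAffine.Point))
    {Wd : WeierstrassCurve ℚ} (Cd : VariableChange ℚ) (hWd : Cd • W.quadraticTwist (NumberField.discr K : ℚ) = Wd)
    (e : (Wd.baseChange K).galH1 ≃+ (W.baseChange K).galH1)
    (he : ∀ c : (Wd.baseChange K).galH1, c ∈ (Wd.baseChange K).sha ↔ e c ∈ (W.baseChange K).sha)
    (T : ℕ) (M : ℕ → ℕ) (hM : ∀ j, M (j + 1) ≤ M j) (hMT : M (2 * T) = 0)
    (x : (m : ℕ) → Fin (2 * m + 2) → W.galH1)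
    (hx : ∀ m < T, (∀ i, resBaseChange W K (x m i) ∈ (W.baseChange K).sha) ∧
      (∀ i, addOrderOf (x m i) = 2 ^ (M (2 * m) - M (2 * m + 1))) ∧
      ∀ c : Fin (2 * m + 2) → ℤ, ∑ i, c i • x m i = 0 → ∀ i, ((2 ^ (M (2 * m) - M (2 * m + 1)) : ℕ) : ℤ) ∣ c i)
    (y : (m : ℕ) → Fin (2 * m + 2) → Wd.galH1)
    (hy : ∀ m < T, (∀ i, resBaseChange Wd K (y m i) ∈ (Wd.baseChange K).sha) ∧
      (∀ i, addOrderOf (y m i) = 2 ^ (M (2 * m + 1) - M (2 * m + 2))) ∧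
      ∀ c : Fin (2 * m + 2) → ℤ, ∑ i, c i • y m i = 0 → ∀ i, ((2 ^ (M (2 * m + 1) - M (2 * m + 2)) : ℕ) : ℤ) ∣ c i)
    (hdis : Disjoint
      ((AddSubgroup.closure (((Finset.range T).biUnion fun m ↦ Finset.univ.image (x m) : Finset W.galH1) : Set W.galH1)).map
        (resBaseChange W K) ⊓ AddSubgroup.torsionBy (W.baseChange K).galH1 2)
      ((AddSubgroup.closure (((Finset.range T).biUnion fun m ↦ Finset.univ.image (y m) : Finset Wd.galH1) : Set Wd.galH1)).map
        ((e : (Wd.baseChange K).galH1 →+ (W.baseChange K).galH1).comp (resBaseChange Wd K)) ⊓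
        AddSubgroup.torsionBy (W.baseChange K).galH1 2)) :
    2 ^ (2 * M 0) ∣ Nat.card (AddCommGroup.primaryComponent (W.baseChange K).sha 2) := by
  -- every generator of the (+)-span is killed by a power of `2`, hence so is every element of the span and of its image
  have hs : ∀ z ∈ (((Finset.range T).biUnion fun m ↦ Finset.univ.image (x m) : Finset W.galH1) : Set W.galH1),
      ∃ n : ℕ, 2 ^ n • z = 0 := by
    intro z hz
    obtain ⟨m, hm, hz'⟩ := Finset.mem_biUnion.mp (Finset.mem_coe.mp hz)
    obtain ⟨i, -, rfl⟩ := Finset.mem_image.mp hz'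
    exact ⟨M (2 * m) - M (2 * m + 1), by rw [← (hx m (Finset.mem_range.mp hm)).2.1 i, addOrderOf_nsmul_eq_zero]⟩
  refine pow_two_mul_dvd_natCard_sha_of_ladders_of_disjoint W K h2 hK2 hrank hodd Cd hWd e he T M hM hMT x hx y hy
    (disjoint_of_disjoint_inf_torsionBy_two _ _ (fun u hu ↦ ?_) hdis)
  obtain ⟨u', hu', rfl⟩ := AddSubgroup.mem_map.mp hu
  obtain ⟨n, hn⟩ := exists_pow_nsmul_eq_zero_of_mem_closure (p := 2) _ hs hu'
  exact ⟨n, by rw [← map_nsmul, hn, map_zero]⟩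

end Capstone

end Summit.BirchSwinnertonDyer.BirchSwinnertonDyer.Theorems.GenusExact.PlusDescent

end
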